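import Literature.Computability.Complexity.LabelCoverFromConstraintGraph
import Literature.Computability.Complexity.LabelCoverListOps
import HarnessLib

/-!
# The constraint table of the dart instance and of the instances `φ_k`, from neighbour and acceptance data

Topic `Computability/Complexity`, namespace `Literature.Computability.Complexity.Expander.RotGraph`.
Continuing `LabelCoverListOps.lean` down to the base of the tree's reduction to gap label cover: the
constraint table of the aliased dart instance `dartBLC G C W hd` (`LabelCoverFromConstraintGraph.lean`) and
the complete list rendering of `dartLC G C W hd k`, expressed through two pieces of `ℕ`-level data about
`(G, C)` — the neighbour function `nbrN v i` and the list `accN v i` of accepting pairs of each dart — which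
is all the polynomial-time machine has to supply about the constraint graph:

* `aliasN`, `dartRows`, `dartTable n d W nbrN accN` and **`conList_dartBLC`**: the table of `dartBLC` is
  `dartTable` whenever `nbrN`, `accN` agree with `G.nbr`, `accPairs C W` (rows dart-major, the tail edge
  before the head edge, projection rows `u ↦` component of `accPairs[u mod |accPairs|]`);
* `dartLCList n d W nbrN accN k` and **`dartLC_eq_dartLCList`**: `dartLC G C W hd k` as the triple
  `(numVars, alphabetSize, constraints)` = `((nd)^k + n^k d^k, (W²)^k, shift (blowAL (d^k) (npowL k)))`;
* `haccB n d accN` and `haccB_iff` — the Boolean test "every dart has an accepting pair".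

## References

* S. Arora, B. Barak, *Computational Complexity: A Modern Approach*, CUP 2009, §1.3, §22.3.1.
-/

namespace Literature.Computability.Complexity

open Finset

namespace Expander

namespace RotGraph

variable {n d : ℕ} (G : RotGraph n d) (C : Fin n → Fin d → ℕ → ℕ → Bool) (W : ℕ) (hd : 0 < d)

/-! ### The table of the dart instance -/

omit G C hd in
/-- The aliased decoding on a list of accepting pairs: `u ↦ acc[u mod |acc|]` (and `(0,0)` if `acc = []`). [folklore] -/
def aliasN (acc : List (ℕ × ℕ)) (u : ℕ) : ℕ × ℕ := if 0 < acc.length then acc.getD (u % acc.length) (0, 0) else (0, 0)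

omit G C hd in
/-- The two rows of a dart `δ = (v, i)`: the tail edge `(δ, v, [alias u .1])` and the head edge `(δ, nbr, [alias u .2])`. [folklore] -/
def dartRows (δ v nb : ℕ) (acc : List (ℕ × ℕ)) : List (ℕ × ℕ × List ℕ) :=
  [(δ, v, (List.range (W * W)).map fun u => (aliasN acc u).1), (δ, nb, (List.range (W * W)).map fun u => (aliasN acc u).2)]

omit G C hd in
/-- **The table of the dart instance from neighbour and acceptance data.** [cite: AroraBarakCC2009, Claim 22.36 (the projection constraints ψ_{i,j})] -/
def dartTable (n d : ℕ) (nbrN : ℕ → ℕ → ℕ) (accN : ℕ → ℕ → List (ℕ × ℕ)) : List (ℕ × ℕ × List ℕ) :=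
  ((List.range n).map fun v => ((List.range d).map fun i => dartRows W (i + d * v) v (nbrN v i) (accN v i)).flatten).flatten

/-- The accepting pairs as pairs of naturals. [folklore] -/
def accNat (v : Fin n) (i : Fin d) : List (ℕ × ℕ) := (accPairs C W v i).map fun p => (p.1.val, p.2.val)

/-- `aliasN` on `accNat` is `aliasDec`. [folklore] -/
theorem aliasN_accNat (δ : Fin n × Fin d) (u : Fin (W * W)) :
    aliasN (accNat C W δ.1 δ.2) u.val = ((aliasDec C W δ u).1.val, (aliasDec C W δ u).2.val) := by
  unfold aliasN aliasDec accNat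
  rw [List.length_map]
  by_cases h : 0 < (accPairs C W δ.1 δ.2).length
  · rw [if_pos h, dif_pos h, List.getD_eq_getElem _ _ (by rw [List.length_map]; exact Nat.mod_lt _ h), List.getElem_map]
  · rw [if_neg h, dif_neg h]

/-- Decoding an edge index `s + 2 (i + d v)`. [folklore] -/
theorem edgeEquiv_mk {v i s : ℕ} (hv : v < n) (hi : i < d) (hs : s < 2) (h : s + 2 * (i + d * v) < n * d * 2) :
    edgeEquiv (⟨s + 2 * (i + d * v), h⟩ : Fin (n * d * 2)) = ((⟨v, hv⟩, ⟨i, hi⟩), ⟨s, hs⟩) := by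
  have hδ : i + d * v < n * d := by
    calc i + d * v < d + d * v := Nat.add_lt_add_right hi _
      _ = d * (v + 1) := by ring
      _ ≤ d * n := Nat.mul_le_mul_left _ hv
      _ = n * d := Nat.mul_comm _ _
  have h1 : (finProdFinEquiv.symm (⟨s + 2 * (i + d * v), h⟩ : Fin (n * d * 2))) = (⟨i + d * v, hδ⟩, ⟨s, hs⟩) := by
    rw [Equiv.symm_apply_eq]; exact Fin.ext (by simp)
  have h2 : (finProdFinEquiv.symm (⟨i + d * v, hδ⟩ : Fin (n * d))) = (⟨v, hv⟩, ⟨i, hi⟩) := by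
    rw [Equiv.symm_apply_eq]; exact Fin.ext (by simp)
  rw [edgeEquiv_apply, h1]
  simp only [h2]

/-- **The table of the dart instance is `dartTable`** for data agreeing with `G.nbr` and `accPairs`. [cite: AroraBarakCC2009, Claim 22.36] -/
theorem conList_dartBLC (nbrN : ℕ → ℕ → ℕ) (accN : ℕ → ℕ → List (ℕ × ℕ))
    (hnbr : ∀ (v : Fin n) (i : Fin d), nbrN v i = (G.nbr v i).val) (hacc : ∀ (v : Fin n) (i : Fin d), accN v i = accNat C W v i) :
    (G.dartBLC C W hd).conList = dartTable W n d nbrN accN := by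
  unfold BLC.conList dartTable
  rw [show (G.dartBLC C W hd).m = n * d * 2 from rfl, List.map_range_mul, List.map_range_mul, List.flatten_flatten, List.map_map]
  refine congrArg List.flatten (List.map_congr_left fun v hv => ?_)
  show ((List.range d).map fun y => (List.range 2).map fun s =>
      ((G.dartBLC C W hd).srcN (s + 2 * (y + d * v)), (G.dartBLC C W hd).dstN (s + 2 * (y + d * v)), (G.dartBLC C W hd).projRow (s + 2 * (y + d * v)))).flatten = _
  refine congrArg List.flatten (List.map_congr_left fun i hi => ?_)
  have hv' := List.mem_range.1 hv
  have hi' := List.mem_range.1 hi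
  -- the two rows
  rw [List.range_succ, List.range_one, List.singleton_append, List.map_cons, List.map_singleton]
  unfold dartRows
  have hrow : ∀ s : ℕ, ∀ hs : s < 2,
      ((G.dartBLC C W hd).srcN (s + 2 * (i + d * v)), (G.dartBLC C W hd).dstN (s + 2 * (i + d * v)), (G.dartBLC C W hd).projRow (s + 2 * (i + d * v))) =
        (i + d * v, (if s = 0 then v else nbrN v i), (List.range (W * W)).map fun u => if s = 0 then (aliasN (accN v i) u).1 else (aliasN (accN v i) u).2) := by
    intro s hs
    have h : s + 2 * (i + d * v) < n * d * 2 := by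
      have hδ : i + d * v < n * d := by
        calc i + d * v < d + d * v := Nat.add_lt_add_right hi' _
          _ = d * (v + 1) := by ring
          _ ≤ d * n := Nat.mul_le_mul_left _ hv'
          _ = n * d := Nat.mul_comm _ _
      lia
    have hE := edgeEquiv_mk (n := n) (d := d) hv' hi' hs h
    simp only [Prod.mk.injEq]
    refine ⟨?_, ?_, ?_⟩
    · rw [BLC.srcN, dif_pos h]
      show ((finProdFinEquiv.symm (⟨s + 2 * (i + d * v), h⟩ : Fin (n * d * 2))).1 : ℕ) = i + d * v
      have := congrArg (fun x => (finProdFinEquiv x.1).val) hE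
      simp only [edgeEquiv_apply, Equiv.apply_symm_apply, finProdFinEquiv_apply_val] at this
      exact this
    · rw [BLC.dstN, dif_pos h]
      show (G.dartEnd (edgeEquiv (⟨s + 2 * (i + d * v), h⟩ : Fin (n * d * 2)))).val = _
      rw [hE]
      unfold dartEnd
      rcases Nat.lt_succ_iff.1 (Nat.lt_succ_iff.2 (Nat.le_of_lt_succ hs)) |>.lt_or_eq with hs0 | hs1
      · have : s = 0 := by lia
        subst this; simp
      · subst hs1
        have := hnbr ⟨v, hv'⟩ ⟨i, hi'⟩
        simp only at this
        simp [this]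
    · unfold BLC.projRow
      rw [show (G.dartBLC C W hd).WB = W * W from rfl]
      refine List.map_congr_left fun u hu => ?_
      have hu' := List.mem_range.1 hu
      rw [BLC.projN, dif_pos ⟨h, hu'⟩]
      show (if (edgeEquiv (⟨s + 2 * (i + d * v), h⟩ : Fin (n * d * 2))).2 = 0 then
          (aliasDec C W (edgeEquiv (⟨s + 2 * (i + d * v), h⟩ : Fin (n * d * 2))).1 ⟨u, hu'⟩).1
          else (aliasDec C W (edgeEquiv (⟨s + 2 * (i + d * v), h⟩ : Fin (n * d * 2))).1 ⟨u, hu'⟩).2).val = _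
      rw [hE]
      have hal := aliasN_accNat C W (⟨v, hv'⟩, ⟨i, hi'⟩) ⟨u, hu'⟩
      rw [← hacc] at hal
      simp only at hal
      rcases Nat.lt_succ_iff.1 (Nat.lt_succ_iff.2 (Nat.le_of_lt_succ hs)) |>.lt_or_eq with hs0 | hs1
      · have : s = 0 := by lia
        subst this; simp [hal]
      · subst hs1; simp [hal]
  rw [hrow 0 (by norm_num), hrow 1 (by norm_num)]
  simp

/-! ### The full rendering of `φ_k` -/

omit G C hd in
/-- Shifting Alice's indices by `nB` and packaging rows as constraints. [folklore] -/
def shiftRows (nB : ℕ) (L : List (ℕ × ℕ × List ℕ)) : List LabelCoverConstraint := L.map fun t => ⟨t.1, nB + t.2.1, t.2.2⟩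

omit G C hd in
/-- The table of the `k`-fold product of the dart instance, iterating `prodL` from `dartTable`. [cite: AroraBarakCC2009, §22.3.1] -/
def dartNpowL (n d : ℕ) (nbrN : ℕ → ℕ → ℕ) (accN : ℕ → ℕ → List (ℕ × ℕ)) : ℕ → List (ℕ × ℕ × List ℕ)
  | 0 => [(0, 0, [0])]
  | k + 1 => BLC.prodL ((n * d) ^ k) (n ^ k) (W ^ k) (dartTable W n d nbrN accN) (dartNpowL n d nbrN accN k)

/-- `dartNpowL` is the table of `dartBLC^{⊗k}`. [folklore] -/
theorem conList_npow_dartBLC (nbrN : ℕ → ℕ → ℕ) (accN : ℕ → ℕ → List (ℕ × ℕ))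
    (hnbr : ∀ (v : Fin n) (i : Fin d), nbrN v i = (G.nbr v i).val) (hacc : ∀ (v : Fin n) (i : Fin d), accN v i = accNat C W v i) :
    ∀ k, ((G.dartBLC C W hd).npow k).conList = dartNpowL W n d nbrN accN k
  | 0 => BLC.conList_unit
  | k + 1 => by
    rw [BLC.npow_succ, BLC.conList_prod, conList_npow_dartBLC nbrN accN hnbr hacc k, G.conList_dartBLC C W hd nbrN accN hnbr hacc,
      BLC.nB_npow, BLC.nA_npow, BLC.WA_npow]
    rfl

omit G C hd in
/-- **The list rendering of `φ_k`**: `(numVars, alphabetSize, constraints)`. [cite: AroraBarakCC2009, Thm. 22.15 (the instances)] -/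
def dartLCList (n d : ℕ) (nbrN : ℕ → ℕ → ℕ) (accN : ℕ → ℕ → List (ℕ × ℕ)) (k : ℕ) : LabelCoverInstance :=
  ⟨(n * d) ^ k + n ^ k * d ^ k, (W * W) ^ k, shiftRows ((n * d) ^ k) (BLC.blowAL (d ^ k) (dartNpowL W n d nbrN accN k))⟩

/-- **`dartLC` is `dartLCList`** for data agreeing with `G.nbr` and `accPairs`. [cite: AroraBarakCC2009, Thm. 22.15] -/
theorem dartLC_eq_dartLCList (nbrN : ℕ → ℕ → ℕ) (accN : ℕ → ℕ → List (ℕ × ℕ))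
    (hnbr : ∀ (v : Fin n) (i : Fin d), nbrN v i = (G.nbr v i).val) (hacc : ∀ (v : Fin n) (i : Fin d), accN v i = accNat C W v i) (k : ℕ) :
    G.dartLC C W hd k = dartLCList W n d nbrN accN k := by
  have hnum := G.dartLC_numVars C W hd k
  have halph := G.dartLC_alphabetSize C W hd k
  unfold dartLC at hnum halph ⊢
  unfold dartLCList
  set X := ((G.dartBLC C W hd).npow k).blowA (d ^ k) (pow_pos hd k) with hX
  have hc := BLC.toLC_constraints_conList X
  rw [show X.toLC = ⟨X.toLC.numVars, X.toLC.alphabetSize, X.toLC.constraints⟩ from rfl]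
  congr 1
  rw [hc, hX, BLC.conList_blowA, G.conList_npow_dartBLC C W hd nbrN accN hnbr hacc k]
  show _ = shiftRows _ _
  unfold shiftRows
  rw [show (((G.dartBLC C W hd).npow k).blowA (d ^ k) (pow_pos hd k)).nB = ((G.dartBLC C W hd).npow k).nB from rfl, BLC.nB_npow]

/-! ### The accepting-pairs test -/

omit G C W hd in
/-- The Boolean test "every dart has an accepting pair" on acceptance data. [folklore] -/
def haccB (n d : ℕ) (accN : ℕ → ℕ → List (ℕ × ℕ)) : Bool :=
  (List.range n).all fun v => (List.range d).all fun i => decide (0 < (accN v i).length)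

/-- `haccB` decides the hypothesis `hacc` of `dartLC_mem_noSet`. [folklore] -/
theorem haccB_iff (accN : ℕ → ℕ → List (ℕ × ℕ)) (hacc : ∀ (v : Fin n) (i : Fin d), accN v i = accNat C W v i) :
    haccB n d accN = true ↔ ∀ (v : Fin n) (i : Fin d), 0 < (accPairs C W v i).length := by
  unfold haccB
  simp only [List.all_eq_true, List.mem_range, decide_eq_true_eq]
  constructor
  · intro h v i
    have := h v v.isLt i i.isLt
    rw [hacc] at this
    simpa only [accNat, List.length_map] using this
  · intro h v hv i hi
    have := h ⟨v, hv⟩ ⟨i, hi⟩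
    have h2 := hacc ⟨v, hv⟩ ⟨i, hi⟩
    simp only at h2
    rw [h2]
    simpa only [accNat, List.length_map] using this

end RotGraph

end Expander

end Literature.Computability.Complexity
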